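import Summits.BirchSwinnertonDyer.BirchSwinnertonDyer.Theorems.ByReductionTypeAtTwoMultTowerPinch
import Summits.BirchSwinnertonDyer.BirchSwinnertonDyer.Theorems.ByReductionTypeAtTwoSlopePinchAlgebraB
import Summits.BirchSwinnertonDyer.BirchSwinnertonDyer.Theorems.ByReductionTypeAtTwoMultKatoNonsplitDescent
import Literature.NumberTheory.EllipticCurves.BSDShaProofs
import HarnessLib

/-!
# Route `ByReductionTypeAtTwo`, children `MultLowerHalfAtTwo` (item stmt-BirchSwinnertonDyer-19923) and
# `MultUpperHalfAtTwo` (19922): the TORSION-TOLERANT SLOPE-PINCH door at a NON-SPLIT multiplicative `2` — `BSD₂(E)`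
# (both halves) WITHOUT `¬ 2 ∣ #E(ℚ)_tors`, from Kato `⊗ℚ` + the tower gap (`μ = 0`) + the first three coefficient
# valuations of `ϖ·L₂(E)` + Cassels–Tate parity + a level-`(m−2)` descent certificate

HONEST FRAMING (cell `bsd-2adic`, run/shared/lean/pub/bsd-2adic/, seat `bsd-2adic-mult-3` GEN 10, HUMAN RULINGS
D-0036 / D-0054 / D-0074 row (A)): research route; THEOREMS ONLY — no definition, no new named fact, nothing asserted,
nothing booked; BSD is not proved by any of this. PARTITION (D-0054): X5@2 mult NON-SPLIT with a rational `2`-torsion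
point (`E[2]` reducible; the «neither» tower classes and the 11 reducible classes with no `K = 2` member) × p = 2 —
types-the-object-of (items 19923 / 19922 per class by ONE door); closes none by itself; 0 un-booked customers today
(designed road RC-118-bis, HOME/HANDOFF.md § bsd-2adic-mult-3 GEN 10 (R1)).

## The road

Every λ-pinch / slope-pinch door of the lane (`MultSelmerRank.*`, GEN 6; `MultSlopePinch.*`, GEN 9) needs `λ(X) ≥ n` from a
layer Selmer count, hence Greenberg Prop. 4.14@2 (`h414`) and `¬ 2 ∣ #E(ℚ)_tors` — false on every `E[2]`-reducible curve.
Here NO lower bound on `λ(X)` is used. With `L₀ = ι⁻¹(ϖ·L₂(E)) ∈ char_Λ X = (f_X)` (Kato `⊗ℚ` + `μ(X) = 0` from the tower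
gap + `0 ≤ ord₂ ϖ`: `integralKato_of_katoRat_of_mu_eq_zero_of_period`), write `L₀ = f_X·b`. §1 proves the IDENTITY
`v₂(b(0)) = ord₂ #Ш_an − ord₂ #Ш` (Greenberg's non-split Euler-characteristic display A235 applied to the generator
`f_X`, the interpolation `L₀(0) = ϖ·2·[0]⁺_f`, and Miller's `#Ш_an = (L(E,1)/Ω)·#E(ℚ)²/∏c` — the torsion and Tamagawa terms
CANCEL). So: a RECORD `ord₂ #Ш_an = m` with `m` even, Cassels–Tate (`exists_casselsTate_pairing` ⇒ `ord₂ #Ш` even) and a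
descent certificate `2^k ∣ #Ш` with `m ≤ k + 2` put `v₂(b(0)) ∈ {0, 2}`; the pure-algebra slope shape B
(`SlopePinch.valuation_coeff_zero_ne_two_of_slopeShape`, file `…SlopePinchAlgebraB`: `v₂(L₀(0)) = s ≥ 6`, `2⁴ ∣ [T¹]L₀`,
`v₂([T²]L₀) = 1`) removes `2`; `b ∈ Λˣ`, `char_Λ X = (L₀)`, and `X5.O1.missingPPartAt_two_nonsplit_of_charIdeal_eq_span` reads
off `BSD₂`. Displayed: PRINT {guarded Thm-4.1 analogue `h41`, `hmod`, `hGZK`, `hCT` (Cassels–Tate, bsd.S18)} + MEMO/PRINT-located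
{K11 `hKato`} + CERTIFICATES {`TowerGapAtTwo W`, `hcoef` (s ≥ 6), `hsha : 2^k ∣ #Ш`, `hper₀`} + RECORD {`hq`/`hv`: `#Ш_an = q`,
`ord₂ q = m` even, `m ≤ k + 2`} + `r_an = 0`. NO `h414`, NO torsion hypothesis, NO `λ_an`, NO `μ_an`.

References: R. Greenberg, LNM 1716 (1999), §4 pp. 112–113; K. Kato, Astérisque 295 (2004), Thm. 17.4, §17.13; B. Mazur,
J. Tate, J. Teitelbaum, Invent. Math. 84 (1986), §I.14; J. W. S. Cassels, J. reine angew. Math. 211 (1962), 95–112 (Ш square);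
J. H. Silverman, *AEC* (2009), Thm. X.4.14; L. Washington, *Introduction to Cyclotomic Fields*, §7.1, §13.2; R. L. Miller, LMS
J. Comput. Math. 14 (2011), Def. 1.1.
-/

set_option autoImplicit false
set_option linter.dupNamespace false

noncomputable section

open scoped Classical MatrixGroups ModularForm

open CongruenceSubgroup WeierstrassCurve Literature.NumberTheory.EllipticCurves
  Literature.NumberTheory.EllipticCurves.ModularForms
  Literature.NumberTheory.EllipticCurves.Wuthrich2014
  Literature.NumberTheory.EllipticCurves.Greenberg1999
  Literature.NumberTheory.EllipticCurves.Rank1Residual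
  Literature.NumberTheory.EllipticCurves.Rank1Residual.Typed Summit.BirchSwinnertonDyer.Rank1Residual
  Summit.BirchSwinnertonDyer.Rank1Residual.X1.MuLambda
  Summit.BirchSwinnertonDyer.Rank1Residual.X5 Summit.BirchSwinnertonDyer.Rank1Residual.X5.O1
  Summit.BirchSwinnertonDyer.BirchSwinnertonDyer.Theorems.SlopePinch
  Summit.BirchSwinnertonDyer.BirchSwinnertonDyer.Theorems.MultSelmerRank

namespace Summit.BirchSwinnertonDyer.BirchSwinnertonDyer.Theorems.MultTorsionSlopePinch

variable (W : WeierstrassCurve ℚ) [W.IsElliptic] [W.IsGloballyMinimal]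

/-! ## §1 The cofactor identity `v₂(b(0)) = ord₂ #Ш_an − ord₂ #Ш` -/

/-- **The COFACTOR IDENTITY at a non-split multiplicative `2` (PROVED).** `W` non-split multiplicative at `2` with
`L(E,1) ≠ 0`; A235 as the hypothesis `hEC`; GZK; a cyclotomic dual datum `D` with `X` torsion and `char_Λ X = (f_X)`;
`L₀ = f_X · b` with `ι L₀ = ϖ·L`, `L` THE `2`-adic `L`-function of the newform `f` (`α = −1`, `L(0) = 2·[0]⁺_f`),
`ϖ·Ω_E = Ω⁺_f`; `#Ш_an = q`. Then `v₂(b(0)) = ord₂ q − ord₂ #Ш(E)`: from `f_X(0)·#E(ℚ)(2)² = u·2^{ord₂∏c+1}·#Sel`,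
`L₀(0) = ϖ·2·[0]⁺_f`, `q = ϖ·[0]⁺_f·#E(ℚ)²/∏c` the torsion and Tamagawa terms cancel.
[cite: GreenbergLNM1716, §4 pp. 112–113 (analogue of Thm. 4.1, l_v = 2)]
[cite: MazurTateTeitelbaum1986Invent, §I.14 (L(0) = (1 − α⁻¹)[0]⁺, α = −1)] [cite: Miller2011LMS, Def. 1.1] -/
theorem valuation_cofactor_eq_sub
    (hEC : TwoAdicEulerCharRankZeroNonsplitMult W 0)
    (hGZK : rank_eq_analyticRank_of_analyticRank_le_one)
    (hmult : Mult W 2) (hns : ¬ W.HasSplitMultiplicativeReductionAtPrime 2)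
    (hL : W.entireLFunction 1 ≠ 0)
    {κ : ZpExtension ℚ 2} {γ : Field.absoluteGaloisGroup ℚ} {N : ℕ} [NeZero N]
    {f : CuspForm (Gamma0 N) 2} (hκ : κ.IsCyclotomic) (hγ : κ.IsTopGenerator γ)
    (hγ' : IsCyclotomicVariable 2 γ) (hf : IsNewformOf W f) {L : PowerSeries ℚ_[2]}
    (hLf : IsMultPAdicLFunctionOf f 2 (-1) L) (D : W.SelmerDualData κ γ) (hX : D.IsTorsion)
    {ϖ : ℚ} (hϖ : (ϖ : ℝ) * W.realPeriodRat = plusPeriod f) {L₀ : IwasawaAlgebra 2}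
    (hL₀ : iwasawaToPowerSeries 2 L₀ = PowerSeries.C (ϖ : ℚ_[2]) * L)
    {fX : IwasawaAlgebra 2} (hchar : D.charIdeal = Ideal.span {fX}) {b : IwasawaAlgebra 2} (hfac : L₀ = fX * b)
    {q : ℚ} (hq : shaAn W = (q : ℂ)) :
    ((PowerSeries.coeff 0 b).valuation : ℤ) = padicValRat 2 q - padicValNat 2 W.shaOrder := by
  have hΩpos : 0 < W.realPeriodRat := W.realPeriodRat_pos_holds
  have hϖ0 : ϖ ≠ 0 := by
    rintro rfl
    have hper : 0 < plusPeriod f := IsNewform0.plusPeriod_pos_holds hf.1 hf.coeffField_eq_bot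
    rw [← hϖ, Rat.cast_zero, zero_mul] at hper
    exact lt_irrefl _ hper
  set sy : ℚ := ratPlusSymbol f 0 with hsy_def
  set t : ℚ := ϖ * sy with ht_def
  have hLval : W.entireLFunction 1 = (((sy : ℝ) * plusPeriod f : ℝ) : ℂ) := hf.entireLFunction_one_eq
  have hqt : W.entireLFunction 1 / (W.realPeriodRat : ℂ) = ((t : ℚ) : ℂ) := by
    rw [hLval, ← hϖ, div_eq_iff (Complex.ofReal_ne_zero.mpr hΩpos.ne'), ht_def]
    push_cast
    ring
  have hsy0 : sy ≠ 0 := by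
    intro h0
    apply hL
    rw [hLval, h0]
    simp
  have ht0 : t ≠ 0 := by rw [ht_def]; exact mul_ne_zero hϖ0 hsy0
  haveI : Module.Finite (IwasawaAlgebra 2) D.X := D.module_finite_holds hγ
  have hsyQ0 : (sy : ℚ_[2]) ≠ 0 := by exact_mod_cast hsy0
  have hϖQ0 : (ϖ : ℚ_[2]) ≠ 0 := by exact_mod_cast hϖ0
  have h20 : (2 : ℚ_[2]) ≠ 0 := two_ne_zero
  -- `L₀(0) = ϖ · 2 · [0]⁺ = f_X(0) · b(0)`
  have hg0 : ((PowerSeries.constantCoeff L₀ : ℤ_[2]) : ℚ_[2]) = (ϖ : ℚ_[2]) * (2 * (sy : ℚ_[2])) := by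
    rw [← constantCoeff_iwasawaToPowerSeries 2 L₀, hL₀, map_mul, PowerSeries.constantCoeff_C,
      hLf.constantCoeff_of_neg_one]
  have hL0fac : PowerSeries.constantCoeff L₀ = PowerSeries.constantCoeff fX * PowerSeries.constantCoeff b := by
    rw [hfac, map_mul]
  have hg00 : PowerSeries.constantCoeff L₀ ≠ 0 := by
    intro h0
    rw [h0, PadicInt.coe_zero] at hg0
    exact (mul_ne_zero hϖQ0 (mul_ne_zero h20 hsyQ0)) hg0.symm
  have hfX00 : PowerSeries.constantCoeff fX ≠ 0 := fun h0 => hg00 (by rw [hL0fac, h0, zero_mul])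
  have hb00 : PowerSeries.constantCoeff b ≠ 0 := fun h0 => hg00 (by rw [hL0fac, h0, mul_zero])
  -- finiteness of `Sel`, `E(ℚ)`, `Ш[2^∞]`, `Ш`
  have hSelfin : Finite (W.selmerGroupPInfty 2) :=
    D.finite_selmerGroupPInfty_of_constantCoeff_ne_zero W hγ hX fX hchar hfX00
  obtain ⟨hEfin, hShapfin⟩ := (W.finite_selmerGroupPInfty_iff 2).mp hSelfin
  haveI := hEfin
  haveI := hShapfin
  haveI := hSelfin
  have hr : W.analyticRank = 0 := analyticRank_eq_zero_of_entireLFunction_one_ne_zero W hL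
  obtain ⟨-, hfin⟩ := hGZK W (by rw [hr]; exact zero_le_one)
  haveI : Finite W.sha := hfin
  -- A235 on the generator `f_X`
  obtain ⟨u₁, hu₁⟩ := hEC hmult hns κ γ hκ hγ hγ' D hX fX hchar hSelfin
  rw [add_zero, zpow_natCast] at hu₁
  haveI : NeZero (2 : ℕ) := ⟨two_ne_zero⟩
  obtain ⟨u₄, hu₄⟩ := exists_unit_torsionOrder_eq W 2
  obtain ⟨u₅, hu₅⟩ := exists_unit_natCard_eq_mul_card_primaryComponent W.sha 2
  have hSel : Nat.card (W.selmerGroupPInfty 2) = Nat.card (AddCommGroup.primaryComponent W.sha 2) :=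
    W.natCard_selmerGroupPInfty_eq_natCard_primaryComponent_sha 2
  set v := padicValNat 2 W.tamagawaProduct with hv
  set Tp : ℚ_[2] := (Nat.card (AddCommGroup.primaryComponent W.toAffine.Point 2) : ℚ_[2]) with hTp
  set Shp : ℚ_[2] := (Nat.card (AddCommGroup.primaryComponent W.sha 2) : ℚ_[2]) with hShp
  have hu₄' : (W.torsionOrder : ℚ_[2]) = ((u₄ : ℤ_[2]) : ℚ_[2]) * Tp := by
    rw [hu₄, hTp]
    congr 1
    exact_mod_cast natCard_primaryComponent_point_congr W 2 _ _
  have hSha : (W.shaOrder : ℚ_[2]) = ((u₅ : ℤ_[2]) : ℚ_[2]) * Shp := by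
    rw [WeierstrassCurve.shaOrder, hShp]
    exact hu₅
  have hSel' : (Nat.card (W.selmerGroupPInfty 2) : ℚ_[2]) = Shp := by rw [hShp, hSel]
  have hTp0 : Tp ≠ 0 := by rw [hTp]; exact_mod_cast Nat.card_pos.ne'
  have hShp0 : Shp ≠ 0 := by rw [hShp]; exact_mod_cast Nat.card_pos.ne'
  have hv2 : (2 : ℚ_[2]).valuation = 1 := by
    have h2 : ((2 : ℕ) : ℚ_[2]).valuation = 1 := Padic.valuation_p
    rwa [Nat.cast_ofNat] at h2
  have hfXQ0 : ((PowerSeries.constantCoeff fX : ℤ_[2]) : ℚ_[2]) ≠ 0 := PadicInt.coe_ne_zero.mpr hfX00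
  have hbQ0 : ((PowerSeries.constantCoeff b : ℤ_[2]) : ℚ_[2]) ≠ 0 := PadicInt.coe_ne_zero.mpr hb00
  -- (a) the Euler-characteristic valuation: `v(f_X(0)) + 2 v(Tp) = v + 1 + v(Shp)`
  have hvalA := congrArg Padic.valuation hu₁
  rw [hSel', Padic.valuation_mul hfXQ0 (pow_ne_zero 2 hTp0), Padic.valuation_pow, PadicInt.valuation_coe,
    Padic.valuation_mul (mul_ne_zero (coe_units_ne_zero 2 u₁) (pow_ne_zero _ h20)) hShp0,
    Padic.valuation_mul (coe_units_ne_zero 2 u₁) (pow_ne_zero _ h20), valuation_coe_units_eq_zero,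
    Padic.valuation_pow, hv2, zero_add] at hvalA
  -- (b) the interpolation valuation: `v(f_X(0)) + v(b(0)) = v(ϖ) + 1 + v(sy)`
  have hvalB := congrArg Padic.valuation hg0
  rw [hL0fac, PadicInt.coe_mul, Padic.valuation_mul hfXQ0 hbQ0, PadicInt.valuation_coe, PadicInt.valuation_coe,
    Padic.valuation_mul hϖQ0 (mul_ne_zero h20 hsyQ0), Padic.valuation_mul h20 hsyQ0, hv2,
    Padic.valuation_ratCast, Padic.valuation_ratCast] at hvalB
  -- (c) torsion / Ш valuations
  have hvT : Tp.valuation = (padicValNat 2 W.torsionOrder : ℤ) := by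
    have h := congrArg Padic.valuation hu₄'
    rw [Padic.valuation_natCast, Padic.valuation_mul (coe_units_ne_zero 2 u₄) hTp0,
      valuation_coe_units_eq_zero, zero_add] at h
    exact h.symm
  have hvS : Shp.valuation = (padicValNat 2 W.shaOrder : ℤ) := by
    have h := congrArg Padic.valuation hSha
    rw [Padic.valuation_natCast, Padic.valuation_mul (coe_units_ne_zero 2 u₅) hShp0,
      valuation_coe_units_eq_zero, zero_add] at h
    exact h.symm
  rw [hvT, hvS] at hvalA
  -- (d) Miller's `#Ш_an = t · #E(ℚ)² / ∏c`, so `ord₂ q = ord₂ t + 2 ord₂ #E(ℚ) − v`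
  obtain ⟨-, hE, -, hshaAn⟩ := shaAn_eq_of_L_one_div_eq hGZK W hL hqt
  haveI := hE
  have hcard : (Nat.card W.toAffine.Point : ℚ) ≠ 0 := by
    exact_mod_cast (Nat.card_pos (α := W.toAffine.Point)).ne'
  have htam : (W.tamagawaProduct : ℚ) ≠ 0 := by
    exact_mod_cast (W.tamagawaProduct_pos_holds : 0 < W.tamagawaProduct).ne'
  have hcardT : (Nat.card W.toAffine.Point : ℚ) = (W.torsionOrder : ℚ) := by
    exact_mod_cast (W.torsionOrder_eq_natCard_of_finite).symm
  have hqeq : q = t * (Nat.card W.toAffine.Point : ℚ) ^ 2 / (W.tamagawaProduct : ℚ) := by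
    have h := hq.symm.trans hshaAn
    exact_mod_cast h
  have hvq : padicValRat 2 q = padicValRat 2 ϖ + padicValRat 2 sy + 2 * (padicValNat 2 W.torsionOrder : ℤ)
      - (v : ℤ) := by
    rw [hqeq, padicValRat.div (mul_ne_zero ht0 (pow_ne_zero 2 hcard)) htam,
      padicValRat.mul ht0 (pow_ne_zero 2 hcard), padicValRat.pow, hcardT, ht_def, padicValRat.mul hϖ0 hsy0]
    simp only [padicValRat.of_nat, Nat.cast_ofNat, hv]
  rw [hvq, PowerSeries.coeff_zero_eq_constantCoeff_apply]
  push_cast at hvalA hvalB ⊢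
  linarith

/-! ## §2 The door -/

/-- **DOOR (TORSION-TOLERANT slope pinch, non-split): `BSDp W 2`, both halves,** for `W/ℚ` globally minimal of
analytic rank `0`, NON-SPLIT multiplicative at `2`, ANY torsion (rational `2`-torsion allowed). Binders: PRINT {guarded
Thm-4.1 analogue `h41`, modularity `hmod`, GZK `hGZK`, Cassels–Tate `hCT` (bsd.S18: `Ш` finite ⇒ `#Ш` square)};
K11 `hKato` (MEMO, or PRINT-located via the descent package); CERTIFICATES {tower gap `hgap` (`μ(X) = 0`), `hper₀`
(`0 ≤ ord₂ ϖ`), the coefficient shape `hcoef` (`v₂([T⁰]G) = s`, `2⁴ ∣ [T¹]G`, `v₂([T²]G) = 1` for every `G` with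
`ι G = ϖ·L`) with `6 ≤ s`, the descent certificate `hsha : 2^k ∣ #Ш(E)`}; RECORD {`hq`: `#Ш_an = q`, `hv`: `ord₂ q = m`,
`hme`: `m` even, `hmk`: `m ≤ k + 2`}; `r_an = 0`. Chain: `integralKato_of_katoRat_of_mu_eq_zero_of_period` ⇒
`L₀ = f_X·b ∈ char X`; §1 ⇒ `v₂(b(0)) = m − ord₂#Ш ≤ 2`; Cassels–Tate ⇒ `≠ 1`; slope shape B ⇒ `≠ 2`; so `b ∈ Λˣ`,
`char X = (L₀)`; `missingPPartAt_two_nonsplit_of_charIdeal_eq_span` ⇒ `BSD₂`. NO `h414`, NO `¬ 2 ∣ #E(ℚ)_tors`, NO `λ_an`/`μ_an`.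
[cite: GreenbergLNM1716, §4 pp. 112–113] [cite: Kato2004Asterisque, Thm. 17.4 (p. 273) and 17.13 (pp. 279–280)]
[cite: SilvermanAEC2009, Thm. X.4.14 (order of a finite Ш is a square)] [cite: Washington1997, §7.1 and §13.2]
[cite: Miller2011LMS, Def. 1.1 and §1] -/
theorem bsdp_two_nonsplit_of_katoRat_of_towerGap_of_shaParitySlope {s m k : ℕ}
    (hKato : O1.KatoMultiplicativeDivisibilityRat W 2)
    (h41 : thm41Analogue_charValue_rankZero_numberField_anyPrime_oddLocalDegree)
    (hmod : nonempty_modularParametrizationData)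
    (hGZK : rank_eq_analyticRank_of_analyticRank_le_one)
    (hCT : WeierstrassCurve.exists_casselsTate_pairing (K := ℚ))
    (hper₀ : ∀ [NeZero (W.conductorNorm ℤ)] (f : CuspForm (Gamma0 (W.conductorNorm ℤ)) 2),
      IsNewformOf W f → ∀ ϖ : ℚ, (ϖ : ℝ) * W.realPeriodRat = plusPeriod f → 0 ≤ padicValRat 2 ϖ)
    (hgap : TowerGapAtTwo W) (hr : W.analyticRank = 0) (hmult : Mult W 2)
    (hns : ¬ W.HasSplitMultiplicativeReductionAtPrime 2)
    (hcoef : ∀ {N : ℕ} [NeZero N] (f : CuspForm (Gamma0 N) 2), IsNewformOf W f →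
      ∀ (ϖ : ℚ), (ϖ : ℝ) * W.realPeriodRat = plusPeriod f →
      ∀ (L : PowerSeries ℚ_[2]), IsMultPAdicLFunctionOf f 2 (-1) L →
      ∀ (G : IwasawaAlgebra 2), iwasawaToPowerSeries 2 G = PowerSeries.C (ϖ : ℚ_[2]) * L →
        (PowerSeries.coeff 0 G).valuation = s ∧ (2 : ℤ_[2]) ^ 4 ∣ PowerSeries.coeff 1 G ∧
          PowerSeries.coeff 2 G ≠ 0 ∧ (PowerSeries.coeff 2 G).valuation = 1)
    (hs6 : 6 ≤ s) {q : ℚ} (hq : shaAn W = (q : ℂ)) (hv : padicValRat 2 q = m) (hme : Even m)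
    (hsha : 2 ^ k ∣ W.shaOrder) (hmk : m ≤ k + 2) : BSDp W 2 := by
  haveI : NeZero (W.conductorNorm ℤ) := ⟨(W.conductorNorm_pos_holds).ne'⟩
  obtain ⟨Dm⟩ := hmod W
  have hf : IsNewformOf W Dm.f := Dm.isNewformOf
  have hL : W.entireLFunction 1 ≠ 0 :=
    (W.analyticRank_eq_zero_iff_holds hf.hasEntireLFunction).mp hr
  obtain ⟨ϖ, -, hϖ, -⟩ := Dm.exists_rat_mul_realPeriodRat_eq_plusPeriod
  obtain ⟨κ, hκ, γ, hγ, hγ'⟩ := exists_isCyclotomic_isTopGenerator_isCyclotomicVariable_holds 2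
  obtain ⟨DW⟩ := W.nonempty_selmerDualData_holds κ γ hγ
  haveI : Module.Finite (IwasawaAlgebra 2) DW.X := DW.module_finite_holds hγ
  obtain ⟨L, hLf⟩ := exists_isMultPAdicLFunctionOf_neg_one_of_nonsplit hf hmult hns
  obtain ⟨hX, hint, -⟩ := integralKato_of_katoRat_of_mu_eq_zero_of_period W hKato
    (mu_eq_zero_of_towerGapAtTwo W hgap) hper₀ hmult κ γ hκ hγ hγ' Dm.f hf ϖ hϖ DW
  obtain ⟨L₀, hKL₀, hL₀⟩ := hint hns L hLf
  -- the generator `f_X` and the cofactor `b`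
  haveI : (Module.charIdeal (IwasawaAlgebra 2) DW.X).IsPrincipal := charIdeal_isPrincipal_holds 2 DW.X
  obtain ⟨fX, hfX⟩ := Submodule.IsPrincipal.principal (Module.charIdeal (IwasawaAlgebra 2) DW.X)
  have hchar : DW.charIdeal = Ideal.span {fX} := hfX
  have hfX0 : fX ≠ 0 := by
    intro h0
    refine Module.charIdeal_ne_bot (IwasawaAlgebra 2) DW.X ?_
    change DW.charIdeal = ⊥
    rw [hchar, h0]
    exact Ideal.span_singleton_eq_bot.mpr rfl
  have hKL₀' := hKL₀
  rw [hchar] at hKL₀'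
  obtain ⟨b, hb⟩ := Ideal.mem_span_singleton'.mp hKL₀'
  have hfac : L₀ = fX * b := by rw [mul_comm, hb]
  -- the coefficient certificate and `L₀(0) ≠ 0`
  obtain ⟨hs, hc1, hc2⟩ := hcoef Dm.f hf ϖ hϖ L hLf L₀ hL₀
  have hid := valuation_cofactor_eq_sub W (twoAdicEulerCharRankZeroNonsplitMult_zero_of_greenberg' W h41) hGZK hmult
    hns hL hκ hγ hγ' hf hLf DW hX hϖ hL₀ hchar hfac hq
  have hc0 : PowerSeries.coeff 0 L₀ ≠ 0 := by
    intro h0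
    have : (PowerSeries.coeff 0 (fX * b)).valuation = s := hfac ▸ hs
    rw [← hfac, h0, PadicInt.valuation_zero] at this
    omega
  -- Cassels–Tate: `ord₂ #Ш` is even; the certificate: `k ≤ ord₂ #Ш`
  haveI : Finite W.sha := (hGZK W (by rw [hr]; exact zero_le_one)).2
  have hsq : IsSquare W.shaOrder := WeierstrassCurve.isSquare_shaOrder_of_casselsTate hCT W (by exact ‹Finite W.sha›)
  have hSha0 : W.shaOrder ≠ 0 := by
    rw [WeierstrassCurve.shaOrder]; exact Nat.card_pos.ne'
  have heven : Even (padicValNat 2 W.shaOrder) := by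
    obtain ⟨r, hr2⟩ := hsq
    have hr0 : r ≠ 0 := by rintro rfl; exact hSha0 (by rw [hr2, mul_zero])
    rw [hr2, padicValNat.mul hr0 hr0]
    exact ⟨_, rfl⟩
  have hk : k ≤ padicValNat 2 W.shaOrder :=
    (padicValNat_dvd_iff_le hSha0).mp hsha
  -- so `v(b₀) ≤ 2` and `v(b₀) ≠ 1`
  rw [hv] at hid
  have hle : (PowerSeries.coeff 0 b).valuation ≤ 2 := by omega
  have hne1 : (PowerSeries.coeff 0 b).valuation ≠ 1 := by
    intro h1
    obtain ⟨m', hm'⟩ := hme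
    obtain ⟨e', he'⟩ := heven
    omega
  -- algebra: `b` is a unit, `char X = (L₀)`
  rw [hfac] at hc0 hs hc1 hc2
  have hspan : Ideal.span ({L₀} : Set (IwasawaAlgebra 2)) = Ideal.span {fX} := by
    rw [hfac]
    exact span_mul_eq_span_of_slopeShape hfX0 hc0 hs hs6 hc1 hc2 hle hne1
  have hcharL : DW.charIdeal = Ideal.span {L₀} := by rw [hchar, hspan]
  exact bsdp_of_missingPPartAt W 2 hGZK (by rw [hr]; exact zero_le_one)
    (missingPPartAt_two_nonsplit_of_charIdeal_eq_span W
      (twoAdicEulerCharRankZeroNonsplitMult_zero_of_greenberg' W h41) hGZK hmult hns hL hκ hγ hγ' hf hLf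
      DW hX hϖ hL₀ hcharL)

/-- **Item 19923 AT the curve: `Typed.MissingLowerBoundAt W 2`** from the torsion-tolerant slope-pinch door (same inputs;
`lower_and_upper_of_missingPPartAt`). [cite: Miller2011LMS, Def. 1.1 (arXiv:1010.2431 p. 3)] [cite: GreenbergLNM1716, §4 pp. 112–113] -/
theorem missingLowerBoundAt_two_nonsplit_of_katoRat_of_towerGap_of_shaParitySlope {s m k : ℕ}
    (hKato : O1.KatoMultiplicativeDivisibilityRat W 2)
    (h41 : thm41Analogue_charValue_rankZero_numberField_anyPrime_oddLocalDegree)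
    (hmod : nonempty_modularParametrizationData)
    (hGZK : rank_eq_analyticRank_of_analyticRank_le_one)
    (hCT : WeierstrassCurve.exists_casselsTate_pairing (K := ℚ))
    (hper₀ : ∀ [NeZero (W.conductorNorm ℤ)] (f : CuspForm (Gamma0 (W.conductorNorm ℤ)) 2),
      IsNewformOf W f → ∀ ϖ : ℚ, (ϖ : ℝ) * W.realPeriodRat = plusPeriod f → 0 ≤ padicValRat 2 ϖ)
    (hgap : TowerGapAtTwo W) (hr : W.analyticRank = 0) (hmult : Mult W 2)
    (hns : ¬ W.HasSplitMultiplicativeReductionAtPrime 2)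
    (hcoef : ∀ {N : ℕ} [NeZero N] (f : CuspForm (Gamma0 N) 2), IsNewformOf W f →
      ∀ (ϖ : ℚ), (ϖ : ℝ) * W.realPeriodRat = plusPeriod f →
      ∀ (L : PowerSeries ℚ_[2]), IsMultPAdicLFunctionOf f 2 (-1) L →
      ∀ (G : IwasawaAlgebra 2), iwasawaToPowerSeries 2 G = PowerSeries.C (ϖ : ℚ_[2]) * L →
        (PowerSeries.coeff 0 G).valuation = s ∧ (2 : ℤ_[2]) ^ 4 ∣ PowerSeries.coeff 1 G ∧
          PowerSeries.coeff 2 G ≠ 0 ∧ (PowerSeries.coeff 2 G).valuation = 1)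
    (hs6 : 6 ≤ s) {q : ℚ} (hq : shaAn W = (q : ℂ)) (hv : padicValRat 2 q = m) (hme : Even m)
    (hsha : 2 ^ k ∣ W.shaOrder) (hmk : m ≤ k + 2) : MissingLowerBoundAt W 2 := by
  haveI : Finite W.sha := (hGZK W (by rw [hr]; exact zero_le_one)).2
  exact (lower_and_upper_of_missingPPartAt W 2 (missingPPartAt_of_bsdp W 2
    (bsdp_two_nonsplit_of_katoRat_of_towerGap_of_shaParitySlope W hKato h41 hmod hGZK hCT hper₀ hgap hr hmult hns hcoef
      hs6 hq hv hme hsha hmk))).1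

/-- **DOOR, DISPLAY FORM for an `E[2]`-REDUCIBLE member: `hper₀` from the period/optimality datum `hPer`** (the class files'
disjunction: an `X₀(N)`-optimal parametrisation datum — then `ord₂ ϖ = 0` by Česnavičius `hC`, odd Manin constant at `2 ∥ N`
(`padicValRat_periodRatio_eq_zero_of_isOptimalDatum`) — or the valuation statement itself); K11 from the PRINT-located descent
package (`MultKatoRat.katoMultiplicativeDivisibilityRat_two_of_descent_nonsplit`). [cite: Cesnavicius2018, Thm. 1.2]
[cite: Kato2004Asterisque, Thm. 17.4 (p. 273) and §17.13] [cite: GreenbergLNM1716, §4 pp. 112–113] [cite: Miller2011LMS, Def. 1.1 and §1] -/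
theorem bsdp_two_nonsplit_of_descent_of_towerGap_of_shaParitySlope_display {s m k : ℕ}
    (hne : Kato2004.nonempty_iwasawaH1Data) (h12 : Kato2004.thm12_4)
    (hdesc : Kato2004.exists_multDivisibilityInputsDescent_nonsplit) (h15 : thm15_isTorsion_multiplicative_rat)
    (h41 : thm41Analogue_charValue_rankZero_numberField_anyPrime_oddLocalDegree)
    (hmod : nonempty_modularParametrizationData)
    (hGZK : rank_eq_analyticRank_of_analyticRank_le_one)
    (hCT : WeierstrassCurve.exists_casselsTate_pairing (K := ℚ))
    (hC : cesnavicius_not_two_dvd_maninConstant_of_two_dvd_level)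
    (hPer : (∀ [NeZero (W.conductorNorm ℤ)],
        ∃ D : ModularParametrizationData W (W.conductorNorm ℤ), Zhai2021.IsOptimalDatum W D) ∨
      (∀ [NeZero (W.conductorNorm ℤ)] (f : CuspForm (Gamma0 (W.conductorNorm ℤ)) 2),
        IsNewformOf W f → ∀ ϖ : ℚ, (ϖ : ℝ) * W.realPeriodRat = plusPeriod f → 0 ≤ padicValRat 2 ϖ))
    (hgap : TowerGapAtTwo W) (hr : W.analyticRank = 0) (hmult : Mult W 2)
    (hns : ¬ W.HasSplitMultiplicativeReductionAtPrime 2)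
    (hcoef : ∀ {N : ℕ} [NeZero N] (f : CuspForm (Gamma0 N) 2), IsNewformOf W f →
      ∀ (ϖ : ℚ), (ϖ : ℝ) * W.realPeriodRat = plusPeriod f →
      ∀ (L : PowerSeries ℚ_[2]), IsMultPAdicLFunctionOf f 2 (-1) L →
      ∀ (G : IwasawaAlgebra 2), iwasawaToPowerSeries 2 G = PowerSeries.C (ϖ : ℚ_[2]) * L →
        (PowerSeries.coeff 0 G).valuation = s ∧ (2 : ℤ_[2]) ^ 4 ∣ PowerSeries.coeff 1 G ∧
          PowerSeries.coeff 2 G ≠ 0 ∧ (PowerSeries.coeff 2 G).valuation = 1)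
    (hs6 : 6 ≤ s) {q : ℚ} (hq : shaAn W = (q : ℂ)) (hv : padicValRat 2 q = m) (hme : Even m)
    (hsha : 2 ^ k ∣ W.shaOrder) (hmk : m ≤ k + 2) : BSDp W 2 := by
  refine bsdp_two_nonsplit_of_katoRat_of_towerGap_of_shaParitySlope W
    (MultKatoRat.katoMultiplicativeDivisibilityRat_two_of_descent_nonsplit W hns hne h12 hdesc h15) h41 hmod hGZK hCT
    ?_ hgap hr hmult hns hcoef hs6 hq hv hme hsha hmk
  intro _ f hf ϖ hϖ
  rcases hPer with hopt | hper
  · obtain ⟨D, hD⟩ := hopt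
    exact (padicValRat_periodRatio_eq_zero_of_isOptimalDatum hC W hmult D hD f hf ϖ hϖ).ge
  · exact hper f hf ϖ hϖ

/-- **Item 19923 AT the curve, DISPLAY FORM** (same inputs as the display door). [cite: Miller2011LMS, Def. 1.1 (arXiv:1010.2431 p. 3)]
[cite: Cesnavicius2018, Thm. 1.2] -/
theorem missingLowerBoundAt_two_nonsplit_of_descent_of_towerGap_of_shaParitySlope_display {s m k : ℕ}
    (hne : Kato2004.nonempty_iwasawaH1Data) (h12 : Kato2004.thm12_4)
    (hdesc : Kato2004.exists_multDivisibilityInputsDescent_nonsplit) (h15 : thm15_isTorsion_multiplicative_rat)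
    (h41 : thm41Analogue_charValue_rankZero_numberField_anyPrime_oddLocalDegree)
    (hmod : nonempty_modularParametrizationData)
    (hGZK : rank_eq_analyticRank_of_analyticRank_le_one)
    (hCT : WeierstrassCurve.exists_casselsTate_pairing (K := ℚ))
    (hC : cesnavicius_not_two_dvd_maninConstant_of_two_dvd_level)
    (hPer : (∀ [NeZero (W.conductorNorm ℤ)],
        ∃ D : ModularParametrizationData W (W.conductorNorm ℤ), Zhai2021.IsOptimalDatum W D) ∨
      (∀ [NeZero (W.conductorNorm ℤ)] (f : CuspForm (Gamma0 (W.conductorNorm ℤ)) 2),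
        IsNewformOf W f → ∀ ϖ : ℚ, (ϖ : ℝ) * W.realPeriodRat = plusPeriod f → 0 ≤ padicValRat 2 ϖ))
    (hgap : TowerGapAtTwo W) (hr : W.analyticRank = 0) (hmult : Mult W 2)
    (hns : ¬ W.HasSplitMultiplicativeReductionAtPrime 2)
    (hcoef : ∀ {N : ℕ} [NeZero N] (f : CuspForm (Gamma0 N) 2), IsNewformOf W f →
      ∀ (ϖ : ℚ), (ϖ : ℝ) * W.realPeriodRat = plusPeriod f →
      ∀ (L : PowerSeries ℚ_[2]), IsMultPAdicLFunctionOf f 2 (-1) L →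
      ∀ (G : IwasawaAlgebra 2), iwasawaToPowerSeries 2 G = PowerSeries.C (ϖ : ℚ_[2]) * L →
        (PowerSeries.coeff 0 G).valuation = s ∧ (2 : ℤ_[2]) ^ 4 ∣ PowerSeries.coeff 1 G ∧
          PowerSeries.coeff 2 G ≠ 0 ∧ (PowerSeries.coeff 2 G).valuation = 1)
    (hs6 : 6 ≤ s) {q : ℚ} (hq : shaAn W = (q : ℂ)) (hv : padicValRat 2 q = m) (hme : Even m)
    (hsha : 2 ^ k ∣ W.shaOrder) (hmk : m ≤ k + 2) : MissingLowerBoundAt W 2 := by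
  haveI : Finite W.sha := (hGZK W (by rw [hr]; exact zero_le_one)).2
  exact (lower_and_upper_of_missingPPartAt W 2 (missingPPartAt_of_bsdp W 2
    (bsdp_two_nonsplit_of_descent_of_towerGap_of_shaParitySlope_display W hne h12 hdesc h15 h41 hmod hGZK hCT hC hPer
      hgap hr hmult hns hcoef hs6 hq hv hme hsha hmk))).1

end Summit.BirchSwinnertonDyer.BirchSwinnertonDyer.Theorems.MultTorsionSlopePinch

end
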